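import Summits.AnomalousDissipation.AnomalousDissipation.Theorems.TaylorCertificatesSteadyStatesLoudBoundedSheetDodgerKolmogorov
import HarnessLib

/-!
# Kolmogorov-mode forces are not Lamb-rigid (negative knowledge for crux stmt-AnomalousDissipation-13038)

The landed residual transfer `stub_residualTransfer` (line `lojasiewicz-lamb-floor-ladder`, re-used by
`lamb-floor-f123-shared-ceiling`) turns the hypothesis `RigidAt f E c δ₀` — every smooth admissible `u` with `∫|u|² ≤ E`
and a residual bound `R ≤ δ₀` has `c ≤ R‖∇u‖₂` — into the crux's FLOOR. By the sheet dodgers of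
`SheetDodgerKolmogorov` this hypothesis is VOID for every Kolmogorov mode `f_k = sin(2πk x₀) e₂`: at the dodgers' energy level,
`RigidAt f_k E c δ₀` fails for all `c, δ₀ > 0` (take `n` with `R_n ≤ δ₀` and `R_n‖∇u_n‖₂ < c`). Pure proof.
-/

noncomputable section

open Filter MeasureTheory
open scoped Topology Real InnerProductSpace

-- `Summit.<Summit>.<Problem>` is the tree's mandated summit-side namespace (CONVENTIONS §2); single-conjunct summit, duplicate deliberate.
set_option linter.dupNamespace false

namespace Summit.AnomalousDissipation.AnomalousDissipation.Theorems.SteadyStatesLoudBounded.SheetDodger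

open Literature.Analysis.FunctionSpaces Literature.Analysis.FunctionSpaces.Torus

/-- **Registered negative-knowledge stub `stub_kolmogorovModeNotRigid`**: for every Kolmogorov mode `f_k` (`k ≥ 1`) there is an
energy level `E` at which the Lamb-rigidity hypothesis `RigidAt f_k E c δ₀` of the landed residual transfer fails for ALL
`c > 0`, `δ₀ > 0` — the floor mechanism of the Lamb-rigidity lines is void on shear-mode forces. -/
theorem stub_kolmogorovModeNotRigid : ∀ k : ℕ, 1 ≤ k → ∃ E : ℝ, ∀ c δ₀ : ℝ, 0 < c → 0 < δ₀ →
    ¬ (∀ u : UnitAddTorus (Fin 3) → EuclideanSpace ℝ (Fin 3),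
        Literature.Analysis.FunctionSpaces.Torus.IsSmooth u → Literature.Analysis.FunctionSpaces.Torus.IsDivFree u →
        Literature.Analysis.FunctionSpaces.Torus.HasZeroMean u → ∫ x, ‖u x‖ ^ 2 ≤ E →
        ∀ R : ℝ, 0 ≤ R →
          (∀ w : UnitAddTorus (Fin 3) → EuclideanSpace ℝ (Fin 3),
            Literature.Analysis.FunctionSpaces.Torus.IsSmooth w → Literature.Analysis.FunctionSpaces.Torus.IsDivFree w →
            Literature.Analysis.FunctionSpaces.Torus.HasZeroMean w →
            |∫ x, inner ℝ (Literature.Analysis.FunctionSpaces.Torus.convect u u x -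
                Literature.Analysis.FunctionSpaces.Torus.twoHalf 0
                  (fun y : UnitAddTorus (Fin 2) => (((@fourier 1 (k : ℤ)) (y 0) : ℂ)).im) x) (w x)| ≤
              R * Real.sqrt (Literature.Analysis.FunctionSpaces.Torus.gradNormSq w)) →
          R ≤ δ₀ → c ≤ R * Real.sqrt (Literature.Analysis.FunctionSpaces.Torus.gradNormSq u)) := by
  intro k hk
  obtain ⟨E, u, R, hmem, hR, hRG, -⟩ := stub_kolmogorovModeOnsagerDodger k hk
  refine ⟨E, fun c δ₀ hc hδ₀ hrig => ?_⟩
  -- eventually `R n ≤ δ₀` and `R n √G_n < c`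
  have h1 : ∀ᶠ n in atTop, R n < δ₀ := hR (Iio_mem_nhds hδ₀)
  have h2 : ∀ᶠ n in atTop, R n * Real.sqrt (Torus.gradNormSq (u n)) < c := hRG (Iio_mem_nhds hc)
  obtain ⟨n, hn1, hn2⟩ := (h1.and h2).exists
  obtain ⟨hs, hdiv, hzero, hE, hR0, hres⟩ := hmem n
  have h := hrig (u n) hs hdiv hzero hE (R n) hR0 hres hn1.le
  linarith

end Summit.AnomalousDissipation.AnomalousDissipation.Theorems.SteadyStatesLoudBounded.SheetDodger

end
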